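import Summits.Ventures.LatticeQCDFlow.Scaling.SwapLadderIndexTauIntThresholdAllK
import Summits.Ventures.LatticeQCDFlow.Scaling.SwapLadderIndexTauIntThreshold
import Summits.Ventures.LatticeQCDFlow.Scaling.SwapLadderIndexTauIntThresholdCard

/-!
HONEST FRAMING: exact (Metropolis-corrected) sampling algorithms for lattice gauge theory; figures
of merit are autocorrelation/cost numbers at stated couplings and volumes; no continuum-physics
claim.

# SwapLadderIndexTauIntThresholdBand — EVERY LADDER WHOSE PAIRS ACCEPT AT MOST `25 %` (IN PARTICULAR EVERY LADDER INSIDE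
# THE CARD'S `20 ± 5 %` TOLERANCE) IS ABOVE THE COLLAPSE THRESHOLD, FOR EVERY NUMBER OF REPLICAS: ITS TOTAL STIFFNESS EXCEEDS
# `Λ_c(K)`, SO THE `τ_int`-OPTIMAL LADDER WITH THE SAME ENDPOINTS EXISTS (row 22 `su3-ptbc`, GEN-8, ours; sequel of
# `SwapLadderIndexTauIntThresholdAllK` and `SwapLadderIndexTauIntThreshold`)

Venture `LatticeQCDFlow` (cell pub-lqcd), topic `Scaling`; FANOUT row 22 (`su3-ptbc`).  NEW WORK of the cell over
`SwapLadderIndexTauIntThresholdAllK` (`thresholdStiffness_le_linear`: `Λ_c(K) ≤ 4√2·0.3711·(K+1)`; `thresholdStiffness_three_le`,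
`thresholdStiffness_four_le`), `SwapLadderIndexTauIntCritGap` (`critGap_le`, `critGap_mono`, `critGap_of_le_one`,
`thresholdStiffness_of_le_two`), `SwapLadderIndexTauIntThresholdPoints` (`ray_point_*`), `SwapLadderIndexTauIntThreshold`
(`exists_isMinOn_gapSimplex`), `SwapLadderIndexTauIntThresholdCard` (`thresholdStiffness_seven_le`), GEN-4's `SwapSpacingBrackets` (`erf_le_partialSum_odd`, `two_div_sqrt_pi_lt`, `erfc_eq_one_sub`)
and GEN-6's `strictAnti_gaussAcc`.  Nothing is cited as a fact; no `native_decide`.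

THE POINT (model statements, value-free).  `SwapLadderIndexTauIntThresholdAllK` places the FLAT-`20 %` ladder above the
collapse threshold for every `K`.  A real run is tuned only to within a tolerance (the card: every pair `20 ± 5 %`).  Here:
* `erfc_081_gt_quarter` (`erfc 0.81 > 1/4`, five Maclaurin terms) ⇒ **`gap_gt_of_gaussAcc_le_quarter`**: a pair accepting
  `≤ 25 %` in the Gaussian model has gap `> 2√2·0.81 ≈ 2.29`;
* `thresholdStiffness_{five,six,eight,nine,ten}_le` — term-by-term bounds `Λ_c(K) ≤ 2√2·{1.8, 2.3, 3.1, 3.3, 4.0}`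
  from the certified points (`K = 7` is `…ThresholdCard`'s `≤ 2√2·2.5`, `K = 3, 4` are in `…AllK`, `K ≥ 11` from its linear
  bound);
* **`thresholdStiffness_lt_sum_of_gaussAcc_le_quarter`** — for EVERY `K ≥ 1` and every gap vector `ℓ_0, …, ℓ_{K−1}` with
  `gaussAcc ℓ_j ≤ 1/4` for all `j`: `Λ_c(K) < Σ_j ℓ_j`;
* **`exists_isMinOn_of_gaussAcc_le_quarter`** — hence a positive `τ_int`-optimal gap vector with the same `K` and the same
  total stiffness EXISTS (and is unique, mirror-symmetric, middle-tight by the earlier files): any ladder inside the card's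
  tolerance band — indeed any with all model acceptances `≤ 25 %` — can be compared with a genuine `τ_int` optimum.
NOT CLAIMED: anything for pairs accepting more than `25 %` (very fine ladders CAN be below threshold: `Λ_c(K) > 0` for
`K ≥ 3`); anything about PTBC itself or a run.
-/

noncomputable section

open Finset Real
open Literature.Analysis.SpecialFunctions (erf erfTerm)
open Literature.ComputerArithmetic.BrentZimmermann2010.AsymptoticExpansions (erfc erfc_pos)

namespace Summit.Ventures.LatticeQCDFlow.Scaling

/-! ## §1 A `25 %` pair has gap `> 2√2·0.81` -/

section Quarter

/-- Five Maclaurin terms at `x = 0.81`. [ours] -/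
theorem erf_partialSum_five_081 : ∑ i ∈ range (2 * 2 + 1), (-1 : ℝ) ^ i * erfTerm (81 / 100) i
    = 37126256789126408661 / 56000000000000000000 := by
  simp only [erfTerm, Finset.sum_range_succ, Finset.sum_range_zero]
  norm_num [Nat.factorial]

/-- **`erfc 0.81 > 1/4`.** [ours] -/
theorem erfc_081_gt_quarter : (1 / 4 : ℝ) < erfc (81 / 100) := by
  have h := erf_le_partialSum_odd (x := 81 / 100) (by norm_num) (by norm_num) 2
  rw [erf_partialSum_five_081] at h
  have h2 : 2 / sqrt π * (37126256789126408661 / 56000000000000000000 : ℝ)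
      ≤ 1.128382 * (37126256789126408661 / 56000000000000000000) :=
    mul_le_mul_of_nonneg_right two_div_sqrt_pi_lt.le (by norm_num)
  rw [erfc_eq_one_sub]
  norm_num at h2 ⊢
  linarith

/-- **A pair with model acceptance `≤ 1/4` has gap `> 2√2·0.81`** (`gaussAcc` is strictly decreasing and
`gaussAcc(2√2·0.81) = erfc 0.81 > 1/4`). [ours] -/
theorem gap_gt_of_gaussAcc_le_quarter {ℓ : ℝ} (h : gaussAcc ℓ ≤ 1 / 4) : 2 * sqrt 2 * (81 / 100) < ℓ := by
  have hval : gaussAcc (2 * sqrt 2 * (81 / 100)) = erfc (81 / 100) := by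
    unfold gaussAcc
    have hs : (2 : ℝ) * sqrt 2 ≠ 0 := by positivity
    rw [show 2 * sqrt 2 * (81 / 100) / (2 * sqrt 2) = (81 / 100 : ℝ) by field_simp]
  by_contra hcon
  rw [not_lt] at hcon
  have hmono := strictAnti_gaussAcc.antitone hcon
  rw [hval] at hmono
  linarith [erfc_081_gt_quarter]

/-- Hence **`K` such pairs have total stiffness `> 2√2·0.81·K`** (`K ≥ 1`). [ours] -/
theorem sum_gap_gt_of_gaussAcc_le_quarter {K : ℕ} (hK : 0 < K) {ℓ : ℕ → ℝ} (h : ∀ j, j < K → gaussAcc (ℓ j) ≤ 1 / 4) :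
    2 * sqrt 2 * (81 / 100) * K < ∑ j ∈ range K, ℓ j := by
  have hlt : ∀ j ∈ range K, 2 * sqrt 2 * (81 / 100) < ℓ j := fun j hj => gap_gt_of_gaussAcc_le_quarter (h j (mem_range.1 hj))
  calc 2 * sqrt 2 * (81 / 100) * K = ∑ _j ∈ range K, 2 * sqrt 2 * (81 / 100) := by
        rw [sum_const, card_range, nsmul_eq_mul]; ring
    _ < ∑ j ∈ range K, ℓ j := sum_lt_sum_of_nonempty ⟨0, mem_range.2 hK⟩ hlt

end Quarter

/-! ## §2 `Λ_c(K)` for `K = 5, …, 10` from the certified points -/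

section Small

/-- `Λ_c(5) ≤ 2√2·1.8` (`w = 5, 8, 9, 8, 5`). [ours] -/
theorem thresholdStiffness_five_le : thresholdStiffness 5 ≤ 2 * sqrt 2 * (9 / 5) := by
  unfold thresholdStiffness
  simp only [sum_range_succ, sum_range_zero, maxPassageWeight, passageWeight]
  norm_num
  have h1 : critGap (81 / 25) ≤ 2 * sqrt 2 * (3 / 5) :=
    (critGap_mono (by norm_num : (81 / 25 : ℝ) ≤ 77 / 20)).trans (critGap_le (by positivity) ray_point_06)
  have h2 : critGap (81 / 64) ≤ 2 * sqrt 2 * (3 / 10) :=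
    (critGap_mono (by norm_num : (81 / 64 : ℝ) ≤ 2)).trans (critGap_le (by positivity) ray_point_03)
  have h3 : critGap 1 = 0 := critGap_of_le_one le_rfl
  linarith

/-- `Λ_c(6) ≤ 2√2·2.3` (`w = 6, 10, 12, 12, 10, 6`). [ours] -/
theorem thresholdStiffness_six_le : thresholdStiffness 6 ≤ 2 * sqrt 2 * (23 / 10) := by
  unfold thresholdStiffness
  simp only [sum_range_succ, sum_range_zero, maxPassageWeight, passageWeight]
  norm_num
  have h1 : critGap 4 ≤ 2 * sqrt 2 * (17 / 20) :=
    (critGap_mono (by norm_num : (4 : ℝ) ≤ 193 / 25)).trans (critGap_le (by positivity) ray_point_085)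
  have h2 : critGap (36 / 25) ≤ 2 * sqrt 2 * (3 / 10) :=
    (critGap_mono (by norm_num : (36 / 25 : ℝ) ≤ 2)).trans (critGap_le (by positivity) ray_point_03)
  have h3 : critGap 1 = 0 := critGap_of_le_one le_rfl
  linarith

/- `Λ_c(7) ≤ 2√2·2.5` is `SwapLadderIndexTauIntThresholdCard.thresholdStiffness_seven_le` (imported). -/

/-- `Λ_c(8) ≤ 2√2·3.1` (`w = 8, 14, 18, 20, 20, 18, 14, 8`). [ours] -/
theorem thresholdStiffness_eight_le : thresholdStiffness 8 ≤ 2 * sqrt 2 * (31 / 10) := by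
  unfold thresholdStiffness
  simp only [sum_range_succ, sum_range_zero, maxPassageWeight, passageWeight]
  norm_num
  have h1 : critGap (25 / 4) ≤ 2 * sqrt 2 * (17 / 20) :=
    (critGap_mono (by norm_num : (25 / 4 : ℝ) ≤ 193 / 25)).trans (critGap_le (by positivity) ray_point_085)
  have h2 : critGap (100 / 49) ≤ 2 * sqrt 2 * (2 / 5) :=
    (critGap_mono (by norm_num : (100 / 49 : ℝ) ≤ 49 / 20)).trans (critGap_le (by positivity) ray_point_04)
  have h3 : critGap (100 / 81) ≤ 2 * sqrt 2 * (3 / 10) :=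
    (critGap_mono (by norm_num : (100 / 81 : ℝ) ≤ 2)).trans (critGap_le (by positivity) ray_point_03)
  have h4 : critGap 1 = 0 := critGap_of_le_one le_rfl
  linarith

/-- `Λ_c(9) ≤ 2√2·3.3` (`w = 9, 16, 21, 24, 25, 24, 21, 16, 9`). [ours] -/
theorem thresholdStiffness_nine_le : thresholdStiffness 9 ≤ 2 * sqrt 2 * (33 / 10) := by
  unfold thresholdStiffness
  simp only [sum_range_succ, sum_range_zero, maxPassageWeight, passageWeight]
  norm_num
  have h1 : critGap (625 / 81) ≤ 2 * sqrt 2 * (17 / 20) :=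
    (critGap_mono (by norm_num : (625 / 81 : ℝ) ≤ 193 / 25)).trans (critGap_le (by positivity) ray_point_085)
  have h2 : critGap (625 / 256) ≤ 2 * sqrt 2 * (2 / 5) :=
    (critGap_mono (by norm_num : (625 / 256 : ℝ) ≤ 49 / 20)).trans (critGap_le (by positivity) ray_point_04)
  have h3 : critGap (625 / 441) ≤ 2 * sqrt 2 * (3 / 10) :=
    (critGap_mono (by norm_num : (625 / 441 : ℝ) ≤ 2)).trans (critGap_le (by positivity) ray_point_03)
  have h4 : critGap (625 / 576) ≤ 2 * sqrt 2 * (1 / 10) :=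
    (critGap_mono (by norm_num : (625 / 576 : ℝ) ≤ 121 / 100)).trans (critGap_le (by positivity) ray_point_01)
  have h5 : critGap 1 = 0 := critGap_of_le_one le_rfl
  linarith

/-- `Λ_c(10) ≤ 2√2·4` (`w = 10, 18, 24, 28, 30, 30, 28, 24, 18, 10`). [ours] -/
theorem thresholdStiffness_ten_le : thresholdStiffness 10 ≤ 2 * sqrt 2 * 4 := by
  unfold thresholdStiffness
  simp only [sum_range_succ, sum_range_zero, maxPassageWeight, passageWeight]
  norm_num
  have h1 : critGap 9 ≤ 2 * sqrt 2 * 1 :=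
    (critGap_mono (by norm_num : (9 : ℝ) ≤ 49 / 4)).trans (critGap_le (by positivity) ray_point_one)
  have h2 : critGap (25 / 9) ≤ 2 * sqrt 2 * (3 / 5) :=
    (critGap_mono (by norm_num : (25 / 9 : ℝ) ≤ 77 / 20)).trans (critGap_le (by positivity) ray_point_06)
  have h3 : critGap (25 / 16) ≤ 2 * sqrt 2 * (3 / 10) :=
    (critGap_mono (by norm_num : (25 / 16 : ℝ) ≤ 2)).trans (critGap_le (by positivity) ray_point_03)
  have h4 : critGap (225 / 196) ≤ 2 * sqrt 2 * (1 / 10) :=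
    (critGap_mono (by norm_num : (225 / 196 : ℝ) ≤ 121 / 100)).trans (critGap_le (by positivity) ray_point_01)
  have h5 : critGap 1 = 0 := critGap_of_le_one le_rfl
  linarith

/-- Packaging: `Λ_c(K) ≤ 2√2·0.81·K` for `3 ≤ K ≤ 10`. [ours] -/
theorem thresholdStiffness_le_of_le_ten {K : ℕ} (h3 : 3 ≤ K) (h10 : K ≤ 10) :
    thresholdStiffness K ≤ 2 * sqrt 2 * (81 / 100) * K := by
  have hs : 0 < sqrt 2 := by positivity
  interval_cases K
  · have h := thresholdStiffness_three_le; push_cast; nlinarith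
  · have h := thresholdStiffness_four_le; push_cast; nlinarith
  · have h := thresholdStiffness_five_le; push_cast; nlinarith
  · have h := thresholdStiffness_six_le; push_cast; nlinarith
  · have h := thresholdStiffness_seven_le; push_cast; nlinarith
  · have h := thresholdStiffness_eight_le; push_cast; nlinarith
  · have h := thresholdStiffness_nine_le; push_cast; nlinarith
  · have h := thresholdStiffness_ten_le; push_cast; nlinarith

end Small

/-! ## §3 Every ladder with pair acceptances `≤ 25 %` is above the threshold -/

section Band

/-- **`Λ_c(K) ≤ 2√2·0.81·K` for every `K ≥ 1`** (`K ≤ 2`: zero; `3 ≤ K ≤ 10`: §2; `K ≥ 11`: the linear bound of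
`SwapLadderIndexTauIntThresholdAllK`, `4√2·0.3711·(K+1) ≤ 2√2·0.81·K ⇔ K ≥ 10.95`). [ours] -/
theorem thresholdStiffness_le_quarterStiffness {K : ℕ} (hK : 0 < K) :
    thresholdStiffness K ≤ 2 * sqrt 2 * (81 / 100) * K := by
  have hs : 0 < sqrt 2 := by positivity
  have hK' : (0 : ℝ) < K := by exact_mod_cast hK
  rcases Nat.lt_or_ge K 3 with h2 | h3
  · rw [thresholdStiffness_of_le_two (by omega)]; positivity
  rcases Nat.lt_or_ge K 11 with h10 | h11
  · exact thresholdStiffness_le_of_le_ten h3 (by omega)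
  · have h := thresholdStiffness_le_linear K
    have hK11 : (11 : ℝ) ≤ K := by exact_mod_cast h11
    nlinarith

/-- **FOR EVERY `K ≥ 1` AND EVERY GAP VECTOR WITH ALL MODEL ACCEPTANCES `≤ 1/4`: `Λ_c(K) < Σ_j ℓ_j`.** [ours] -/
theorem thresholdStiffness_lt_sum_of_gaussAcc_le_quarter {K : ℕ} (hK : 0 < K) {ℓ : ℕ → ℝ}
    (h : ∀ j, j < K → gaussAcc (ℓ j) ≤ 1 / 4) : thresholdStiffness K < ∑ j ∈ range K, ℓ j :=
  (thresholdStiffness_le_quarterStiffness hK).trans_lt (sum_gap_gt_of_gaussAcc_le_quarter hK h)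

/-- **HENCE A POSITIVE `τ_int`-OPTIMAL GAP VECTOR WITH THE SAME `K` AND TOTAL STIFFNESS EXISTS** for every such ladder
(`SwapLadderIndexTauIntThreshold.exists_isMinOn_gapSimplex`). [ours] -/
theorem exists_isMinOn_of_gaussAcc_le_quarter {K : ℕ} (hK : 0 < K) {ℓ : ℕ → ℝ}
    (h : ∀ j, j < K → gaussAcc (ℓ j) ≤ 1 / 4) :
    ∃ v ∈ gapSimplex K (∑ j ∈ range K, ℓ j), IsMinOn (gapIndexCost K) (gapSimplex K (∑ j ∈ range K, ℓ j)) v :=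
  exists_isMinOn_gapSimplex hK (thresholdStiffness_lt_sum_of_gaussAcc_le_quarter hK h)

end Band

end Summit.Ventures.LatticeQCDFlow.Scaling

end
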